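import Literature.Combinatorics.Optimization.TracialDesigns
import HarnessLib

/-!
# Cell pnp-psdrank, route `ChebyshevTracialDesign`: the SQUARED-SLACK reweighting of an exact design is again an exact design
# (crux `TracialDecayExp20`, stmt-PneNP-19878; companion of brick 42 `…UnconstrainedSquareSlack`)

Brick 43 (prover g9). For an exact extrapolation design `(C, w)` of degree `D ≥ 3` on the odd levels `3 ≤ c ≤ T` of the `t`-cuts
(`IsExactDesign n t T D B C w`) put `w̃_c := w_c·(c−1)²`. Then

* `levelWeight_sqSlack`: the multilevel weight of `w̃` is the squared-slack reweighting of that of `w`,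
  `levelWeight n t C w̃ (U,M) = (cc(U,M)−1)² · levelWeight n t C w (U,M)`;
* `isExactDesign_sqSlack`: `(C, w̃)` is an exact design of degree `D − 2` with variation `≤ B·T²`: it is normalised
  (`Σ_c w̃_c(c−1) = Σ_c w_c(c−1)³ = 1` by exactness on `(X−1)³`) and exact at the virtual level for every polynomial `p` of degree `≤ D−2`
  (`Σ_c w̃_c p(c) = Σ_c w_c ((X−1)²p)(c) = −p(0)`).

So every design-generic statement of the route (a priori bounds, profile polynomial, crossing-pin lemma) applies verbatim to `W̃ = W·(cc−1)²`,
the weight against which brick 42 shows the crux forces decay of COMPLETELY UNCONSTRAINED psd strategies. [cite: Rothvoss2017, §2 (PDF p. 6)]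
[cite: CoppersmithRivlin1992, Thm. (p. 970)]
Stature: support/instrument. WHAT THIS IS NOT: no bound on any value, nothing on psd rank, no P-vs-NP content.
-/

set_option linter.dupNamespace false -- `Summit.PneNP.PneNP.…`: summit = sub-problem (D-0017)

noncomputable section

namespace Summit.PneNP.PneNP.Theorems.ChebyshevTracialDesignSquareSlackDesign

open scoped Classical

open Finset Matrix Polynomial Literature.Barriers.PneNP Literature.Combinatorics.Optimization

variable {n : ℕ}

/-- **The weight of the reweighted design is the squared-slack reweighting of the weight.** -/
theorem levelWeight_sqSlack (t : ℕ) (C : Finset ℕ) (w : ℕ → ℝ) (U : OddSet n) (M : PMatch n) :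
    levelWeight n t C (fun c => w c * ((c : ℝ) - 1) ^ 2) U M = pmOddCutSlack n U M ^ 2 * levelWeight n t C w U M := by
  unfold levelWeight
  rw [mul_sum]
  refine sum_congr rfl fun c _ => ?_
  by_cases h : (U, M) ∈ Qset n t c
  · rw [if_pos h, if_pos h, pmOddCutSlack_apply]
    have hc : cc U M = c := (mem_Qset_iff.1 h).2
    rw [hc]; ring
  · rw [if_neg h, if_neg h, mul_zero]

/-- **The squared-slack reweighting of an exact design is an exact design** of degree `D − 2` and variation `≤ B·T²` (for `D ≥ 3`).
[cite: CoppersmithRivlin1992, Thm. (p. 970)] [cite: Rothvoss2017, §2 (PDF p. 6)] -/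
theorem isExactDesign_sqSlack {t T D : ℕ} {B : ℝ} {C : Finset ℕ} {w : ℕ → ℝ} (h : IsExactDesign n t T D B C w) (hD : 3 ≤ D) :
    IsExactDesign n t T (D - 2) (B * (T : ℝ) ^ 2) C (fun c => w c * ((c : ℝ) - 1) ^ 2) := by
  obtain ⟨hodd, h2t, hTt, hC, hnorm, hexact, hvar⟩ := h
  refine ⟨hodd, h2t, hTt, hC, ?_, fun p hp => ?_, ?_⟩
  · -- normalisation: `Σ w_c (c−1)³ = 1` from exactness on `(X − 1)³`
    have h3 := hexact ((X - Polynomial.C (1 : ℝ)) ^ 3) (by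
      rw [natDegree_pow, natDegree_X_sub_C]; omega)
    simp only [eval_pow, eval_sub, eval_X, eval_C] at h3
    calc ∑ c ∈ C, w c * ((c : ℝ) - 1) ^ 2 * ((c : ℝ) - 1) = ∑ c ∈ C, w c * ((c : ℝ) - 1) ^ 3 :=
          sum_congr rfl fun c _ => by ring
      _ = 1 := by rw [h3]; norm_num
  · -- exactness in degree `≤ D − 2`: apply the design to `(X − 1)²·p`
    have hq := hexact ((X - Polynomial.C (1 : ℝ)) ^ 2 * p) (by
      calc ((X - Polynomial.C (1 : ℝ)) ^ 2 * p).natDegree ≤ ((X - Polynomial.C (1 : ℝ)) ^ 2).natDegree + p.natDegree := natDegree_mul_le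
        _ ≤ 2 + (D - 2) := by rw [natDegree_pow, natDegree_X_sub_C]; omega
        _ ≤ D := by omega)
    simp only [eval_mul, eval_pow, eval_sub, eval_X, eval_C] at hq
    calc ∑ c ∈ C, w c * ((c : ℝ) - 1) ^ 2 * p.eval (c : ℝ) = ∑ c ∈ C, w c * (((c : ℝ) - 1) ^ 2 * p.eval (c : ℝ)) :=
          sum_congr rfl fun c _ => by ring
      _ = -p.eval 0 := by rw [hq]; norm_num
  · -- variation: `(c − 1)² ≤ T²` on the design levels
    calc ∑ c ∈ C, |w c * ((c : ℝ) - 1) ^ 2| ≤ ∑ c ∈ C, |w c| * (T : ℝ) ^ 2 := sum_le_sum fun c hc => by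
          rw [abs_mul, abs_of_nonneg (sq_nonneg ((c : ℝ) - 1))]
          refine mul_le_mul_of_nonneg_left ?_ (abs_nonneg _)
          obtain ⟨-, h3c, hcT, -⟩ := hC c hc
          have h1 : (1 : ℝ) ≤ c := by exact_mod_cast (by omega : 1 ≤ c)
          have h2 : (c : ℝ) ≤ T := by exact_mod_cast hcT
          nlinarith
      _ = (∑ c ∈ C, |w c|) * (T : ℝ) ^ 2 := by rw [sum_mul]
      _ ≤ B * (T : ℝ) ^ 2 := mul_le_mul_of_nonneg_right hvar (sq_nonneg _)

/-- The balanced version. -/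
theorem isBalancedDesign_sqSlack {t T D : ℕ} {B : ℝ} {C : Finset ℕ} {w : ℕ → ℝ} (h : IsBalancedDesign n t T D B C w) (hD : 3 ≤ D) :
    IsBalancedDesign n t T (D - 2) (B * (T : ℝ) ^ 2) C (fun c => w c * ((c : ℝ) - 1) ^ 2) :=
  ⟨isExactDesign_sqSlack h.1 hD, h.2⟩

end Summit.PneNP.PneNP.Theorems.ChebyshevTracialDesignSquareSlackDesign

end
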